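import Literature.AlgebraicGeometry.Frobenioids.ArchimedeanIsotropy
import HarnessLib

/-!
# Frobenioids II, Example 3.3 (ii): isotropy propagates along arrows; endomorphisms of isotropic objects are co-angular

Mochizuki, *The geometry of Frobenioids II: poly-Frobenioids*, Kyushu J. Math. **62** (2008)
401–460, §3, Example 3.3 (ii), author's text p. 28 [cite: MochizukiFrdII2008, Ex 3.3 (ii) p.28]:
"every endomorphism of an isotropic object of `C` is co-angular".

PROVED here (discharging `ArchFrd.Ex33ii_endo_of_isotropic π`), in the stronger form familiar from
[FrdI] Prop. 1.4 (i) / Def. 1.3 (vii)(b): if `X → P` is any arrow of `C₀` and `A_X` is isotropic then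
`A_P` is isotropic (`C0.isNaivelyIsotropic_of_hom`: the image of a full punctured disc under
`a ↦ c · a^d` meets every direction), hence every arrow out of an isotropic object of `C = C₀ ×_{D₀} D`
is co-angular (`C.isCoAngular_of_isIsotropic`): the middle isometric pre-step of any factorisation
starts at an isotropic object and is therefore an isomorphism (`Ex33ii_isotropic_iff_holds`).
-/

namespace Literature.AlgebraicGeometry.Frobenioids

open CategoryTheory Opposite
open scoped Pointwise NNReal

noncomputable section

namespace ArchFrd

/-- In an isotropic angular region of tip `t`, every unit of absolute value `≤ t^n` is a product of
`n ≥ 1` elements of the region. [cite: MochizukiFrdII2008, Def 3.1 (iii) p.24] -/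
theorem mem_carrier_pow_of_isIsotropic (A : AngularRegion ℂ) (hA : A.IsIsotropic) :
    ∀ n : ℕ, 1 ≤ n → ∀ u : ℂˣ, ‖(u : ℂ)‖ ≤ (A.tip : ℝ) ^ n → u ∈ A.carrier ^ n := by
  have memA : ∀ u : ℂˣ, ‖(u : ℂ)‖ ≤ (A.tip : ℝ) → u ∈ A.carrier := fun u hu => by
    rw [C0.mem_carrier_of_isIsotropic hA, ← Subtype.coe_le_coe, coe_absHom]
    exact hu
  refine Nat.le_induction ?_ ?_
  · intro u hu
    rw [pow_one] at hu ⊢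
    exact memA u hu
  · intro n hn ih u hu
    have ht : 0 < (A.tip : ℝ) := A.tip.2
    have hsplit : u = (u * (ofPosReal ℂ A.tip)⁻¹) * ofPosReal ℂ A.tip := by rw [inv_mul_cancel_right]
    rw [pow_succ, hsplit]
    refine Set.mul_mem_mul (ih _ ?_) (memA _ ?_)
    · rw [Units.val_mul, Units.val_inv_eq_inv_val, norm_mul, norm_inv, coe_ofPosReal,
        RCLike.norm_ofReal, abs_of_pos ht]
      rw [pow_succ] at hu
      exact (mul_inv_le_iff₀ ht).mpr hu
    · rw [coe_ofPosReal, RCLike.norm_ofReal, abs_of_pos ht]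

/-- `unitPart (z · r) = z` for `z ∈ S¹`, `r > 0`. [cite: MochizukiFrdII2008, Def 3.1 (ii) p.24] -/
theorem unitPart_coe_mul_ofPosReal (z : normOneSubgroup ℂ) (r : PosReal) :
    unitPart ℂ ((z : ℂˣ) * ofPosReal ℂ r) = z :=
  (Prod.ext_iff.mp ((unitDecomposition ℂ).symm_apply_apply (z, r))).1

namespace C0

variable {X Y : C0}

/-- **Isotropy propagates along arrows of `C₀`**: if `A_X` is isotropic and `X → Y` is an arrow, then
`A_Y` is isotropic (the image `c · A_X^{⊗d}` of a full punctured disc meets every direction of `S¹`).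
[cite: MochizukiFrdII2008, Ex 3.3 (ii) p.28] -/
theorem isNaivelyIsotropic_of_hom (φ : X ⟶ Y) (hX : X.IsNaivelyIsotropic) : Y.IsNaivelyIsotropic := by
  refine Set.eq_univ_of_forall fun z => ?_
  -- the radius `r = |c| · tip_X^d` and the test element `a = c⁻¹ · σ(z · r)` of `A_X^{⊗d}`
  have hc : 0 < ‖(scalar φ : ℂ)‖ := norm_pos_iff.mpr (scalar φ).ne_zero
  let r : PosReal := ⟨‖(scalar φ : ℂ)‖ * X.tip ^ (degFr φ : ℕ), mul_pos hc (pow_pos X.tip_pos _)⟩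
  let a : ℂˣ := (scalar φ)⁻¹ * (Base φ).act ((z : ℂˣ) * ofPosReal ℂ r)
  have ha : a ∈ X.region.carrier ^ (degFr φ : ℕ) := by
    refine mem_carrier_pow_of_isIsotropic X.region hX _ (degFr φ).pos a ?_
    change ‖(((scalar φ)⁻¹ * D0.galAct (D0.Hom.twists (Base φ)) ((z : ℂˣ) * ofPosReal ℂ r) : ℂˣ) : ℂ)‖
      ≤ X.tip ^ (degFr φ : ℕ)
    rw [Units.val_mul, norm_mul, D0.norm_galAct, Units.val_mul, norm_mul, Units.val_inv_eq_inv_val,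
      norm_inv, coe_ofPosReal, RCLike.norm_ofReal, abs_of_pos r.2,
      (mem_normOneSubgroup_iff ℂ _).mp z.2, one_mul]
    change ‖(scalar φ : ℂ)‖⁻¹ * (‖(scalar φ : ℂ)‖ * X.tip ^ (degFr φ : ℕ)) ≤ X.tip ^ (degFr φ : ℕ)
    rw [← mul_assoc, inv_mul_cancel₀ hc.ne', one_mul]
  obtain ⟨p, hp, hpe⟩ := φ.mapsTo (Set.smul_mem_smul_set ha)
  -- `σ(p) = c · a = σ(z · r)`, so `p = z · r` has angular part `z`
  have hp' : p = (z : ℂˣ) * ofPosReal ℂ r := by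
    apply (Base φ).act.injective
    rw [hpe, smul_eq_mul]
    change scalar φ * ((scalar φ)⁻¹ * (Base φ).act ((z : ℂˣ) * ofPosReal ℂ r)) = _
    rw [mul_inv_cancel_left]
  have hdir := hp.1
  rw [hp', unitPart_coe_mul_ofPosReal] at hdir
  exact hdir

end C0

universe v u

variable {D : Type u} [Category.{v} D] (π : D ⥤ D0)

/-- **Every arrow out of an isotropic object of `C` is co-angular** (cf. [FrdI] Prop. 1.4 (i)): in a
factorisation `γ ≫ β ≫ α`, the domain of the isometric pre-step `β` receives an arrow from the isotropic
object, hence is isotropic, so `β` is an isomorphism. [cite: MochizukiFrdII2008, Ex 3.3 (ii) p.28] -/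
theorem C.isCoAngular_of_isIsotropic {X Y : C π} (φ : X ⟶ Y)
    (hX : PreFrobenioid.IsIsotropic (C.toElem π) X) : PreFrobenioid.IsCoAngular (C.toElem π) φ := by
  intro P Q γ β α _ _ hisom hpre _
  have hXn : X.fst.IsNaivelyIsotropic := (Ex33ii_isotropic_iff_holds π X).mp hX
  have hPn : P.fst.IsNaivelyIsotropic := C0.isNaivelyIsotropic_of_hom γ.fst hXn
  exact (Ex33ii_isotropic_iff_holds π P).mpr hPn β hisom hpre

/-- **Example 3.3 (ii)**: "every endomorphism of an isotropic object of `C` is co-angular" — PROVED.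
[cite: MochizukiFrdII2008, Ex 3.3 (ii) p.28] -/
theorem Ex33ii_endo_of_isotropic_holds : Ex33ii_endo_of_isotropic π :=
  fun _ φ hX => C.isCoAngular_of_isIsotropic π φ hX

/-- **Example 3.3 (ii)**, (b) ⇒ (c): a Frobenius-trivial object is Frobenius-ample (the section `ζ`
provides an endomorphism of every Frobenius degree) — the formal half of "(b) ⟺ (c)", valid in any
pre-Frobenioid. [cite: MochizukiFrdII2008, Ex 3.3 (ii) p.28] -/
theorem isFrobeniusAmple_of_isFrobeniusTrivial {X : C π}
    (h : PreFrobenioid.IsFrobeniusTrivial (C.toElem π) X) : PreFrobenioid.IsFrobeniusAmple (C.toElem π) X := by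
  obtain ⟨ζ, hζ⟩ := h
  exact fun n => ⟨ζ n, (hζ n).1⟩

end ArchFrd

end

end Literature.AlgebraicGeometry.Frobenioids
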